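/-
Copyright: publication-cell `pub-balaban` (b2b), seat b2b-balaban-b10 gen 19 (v1).  Literature leaf — COMPOSITION ONLY:
the three leaves (L1′)/(L2′)/(L3′) of `…B10Eq61PerSite` supplied at once, (L1′)/(L2′) by `…B10Eq29TubeLine` (this
lineage) and (L3′) by `…B13DerivZeroGauge` (b13 lineage), plus the one [folklore] fact that joins them (the tube is a
neighbourhood of every unitary configuration: `exp` is a local homeomorphism at `0`).  Every theorem kernel-proved and
tagged; the `def`s (`expChart`; the §4 example data over `M₂(ℂ)`) are MODEL OBJECTS; NO new cited facts, NO new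
quotations, NO summit vocabulary.
-/
import Mathlib
import Literature.MathematicalPhysics.QuantumFieldTheory.Balaban1983to89.B10Eq29TubeLine
import Literature.MathematicalPhysics.QuantumFieldTheory.Balaban1983to89.B13DerivZeroGauge
import Literature.MathematicalPhysics.QuantumLattice.LieTrotter

/-!
# `Balaban1983to89.B10Eq61Leaves` — [Balaban1985UV3] (61) p. 271 / (I.1.18) [Balaban1988RG2Cluster] p. 21 for the
# differenced pieces: the second-order theorem of `B10Eq61PerSite` with ALL THREE LEAVES SUPPLIED — (L1′) the line
# (29) stays in the tube, (L2′) holomorphy along it (`B10Eq29TubeLine`), (L3′) no first-order term by the global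
# gauge invariance (26) + detecting generators (`B13DerivZeroGauge`) — in the C⋆-algebra model

T. Bałaban, *Ultraviolet stability of three-dimensional lattice pure gauge field theories*, Commun. Math. Phys. **102**,
255–275 (1985) [Balaban1985UV3] (cell paper B10); T. Bałaban, *Renormalization group approach to lattice gauge field
theories. II*, Commun. Math. Phys. **116**, 1–22 (1988) [Balaban1988RG2Cluster] = [II] (cell paper B13).  This module
QUOTES NOTHING NEW: every printed sentence it leans on is located verbatim in `…B10Eq61PerSite` §0 (B10 pp. 263–264,
271–272; [II] pp. 15, 20–21; [I] p. 262; [5] p. 396) and `…B13DerivZeroGauge` §0 (B10 (26), (30)–(32); [I] (1.19),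
(4.13)–(4.14)).  Siblings imported BY NAME (byte-identical): `…B10Eq29TubeLine` (b10-g19: `Tube`, `TubeCfg`, `expLine`,
`bound118_secondOrder_expLine_of_R21`, `logHalfBound_secondOrder_expLine_of_R21`), `…B13DerivZeroGauge` (b13-g15
p184821: `InChart`, `inChart_of_smul`, `derivZeroAlongV_of_linearInvariant`, `derivZeroAlongV_of_semisimple`), hence
`…B10Eq61PerSite`, `…B12Ward414`, `…B13`; and, for §4 only, the tree's `Literature.MathematicalPhysics.QuantumLattice.
LieTrotter` (`norm_exp_le`: `‖exp a‖ ≤ e^{‖a‖}`, [folklore]).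

WHY THIS MODULE.  `B10Eq61PerSite` (v1.1) reduces the absolute per-cube constant of the `U_{k+1} = 1` subtraction (61)
at second order to three leaves about the complex line of (29) plus the undifferenced bound and the printed R21.  The
two lineages discharged them separately and deliberately import-disjointly: `B10Eq29TubeLine` gives (L1′)+(L2′) for
EXPONENTIAL LINES `ζ ↦ (exp(ζ • gen X φ b) * base X φ b)_b` (generator bondwise skew-adjoint and bounded, base unitary,
analyticity space containing the bondwise tube, terms holomorphic there), `B13DerivZeroGauge` gives (L3′) for lines
that pass through the unit configuration INSIDE A CHART (`InChart chart sp' line`: near `ζ = 0`, `line X φ ζ =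
chart X (γ ζ)`, `γ 0 = 0`) from (a) differentiability of `E X ∘ chart X` at `0`, (b) invariance under a group acting
linearly in the chart, (c) detecting generators.  This module is the JOIN, and it is not quite free: (1) the chart is
forced — `expChart base₀ X v = (exp(v b) * base₀ X b)_b`, the exponential chart at a base configuration `base₀ X`
which must be φ-INDEPENDENT (`InChart` pins `line X φ 0 = chart X 0`; this is the cell's reading that the subtracted
configuration is the FIXED POINT of the global action — `U_{k+1} = 1` in d = 3, `(𝐔, 𝐉) = (1, 0)` for [II] p. 21 —,
GAPS C-adv2-66 R1 (adv2-g44), honoured here BY CONSTRUCTION: `expLine gen (fun X _ => base₀ X)`), and then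
`inChart_expLine` is `inChart_of_smul` with `γ ζ = ζ • gen X φ`; (2) b13's binder (a) is DERIVED, not assumed: the
tube `Tube 𝔸 a` is a NEIGHBOURHOOD of every unitary (§1, `tube_mem_nhds_of_mem_unitary` — `exp` is a local
homeomorphism at `0`, Mathlib `hasStrictFDerivAt_exp_zero` + `HasStrictFDerivAt.map_nhds_eq_of_equiv`, and
`V ↦ V·U₀*` is continuous), so `TubeCfg ι 𝔸 a ⊆ sp X` makes `sp X` a neighbourhood of the base configuration and
"`E X` holomorphic on `sp X`" (b10's binder) gives differentiability of `E X ∘ expChart base₀ X` at `0`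
(`differentiableAt_comp_expChart_zero`); (3) the DETECTING hypothesis (c) must be read RELATIVE to the generator
directions: b13's abstract theorem asks the symmetry generators' ranges to span densely the WHOLE chart space `V`,
which is right when `V = 𝔤` but not in the `𝔸`-valued chart of the C⋆-model (`ι → 𝔸 ⊋ 𝔤`; conjugations never
detect the centre — §4 `example_fderiv_apply_center`: for `E = tr`, `D(E ∘ expChart)(0)(1) = 2 ≠ 0`), so §3b proves
the relative form — `Dg(0)` vanishes on the CLOSED SPAN of the generators' ranges, and (L3′) follows as soon as the
line's generator `gen X φ` lies there (the printed `𝓗(B) ∈ 𝔤`, p. 264) —, which is the paper-faithful reading and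
the one admitting a joint instance (§4).  RESULT (§3): `bound118_secondOrder_expLine_of_linearInvariant` — the
(I.1.18)-shape for the differenced pieces with the L, M-independent constant `(16A(1 + c₀²)/a²)·c₁` at rate `r − 3`,
whose binders are now ONLY: generator skew-adjoint with `‖gen X φ b‖ ≤ α₁ + c₀·LM·α₀·(1 + d(X))` on `sp' X`, base
configuration unitary, `TubeCfg ι 𝔸 a ⊆ sp X`, `E X` holomorphic on `sp X`, the (26)-invariance of `E X` in the chart
on a ball + detecting generators (absolute: dense span; or the semisimple Lie model, `…_of_semisimple`; or — §3b,
`bound118_secondOrder_expLine_of_mem_closure` — relative: `gen X φ ∈ closure (span ℂ (⋃ l, range (L l)))`), the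
undifferenced per-LM-cube bound `A(LM)⁴` at rate `r`, the volume bound, the printed R21 — i.e. exactly the located
«by reference / in the same way» inputs (α), (β) of GAPS G-B13-12a UPDATE (b10-g18)/(b13-g15) and nothing else.
RESULT (§4): every binder of the generic-letters relative theorem `logHalfBound_expLine_of_mem_closure` holds AT ONCE
for one bond over `M₂(ℂ)` — generator `K = iπ(E₁₁ − E₂₂) = ad_{E₁₂}(iπE₂₁)`, base `1`, `E = tr`, symmetry =
conjugation by `exp(tE₁₂)` (linear in the chart, velocity `ad_{E₁₂}`), (26) = conjugation-invariance of the trace —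
and non-degenerately: the differenced family is `tr exp K − tr 1 = −4` (`example_diffAlongV_m2`).

CITATION HEADER (lean-in-tree rule).  WHAT IS REPRODUCED: nothing new (see above).  WHAT IS KERNEL-CERTIFIED:
* §1 [folklore] — `map_exp_nhds_zero` (`map exp (𝓝 0) = 𝓝 1` in a C⋆-algebra), `tube_mem_nhds_of_mem_unitary`
  (`0 < a`, `U₀` unitary ⇒ `Tube 𝔸 a ∈ 𝓝 U₀`), `tubeCfg_mem_nhds` (finitely many bonds, bondwise).
* §2 — THE EXPONENTIAL CHART `expChart base₀` [cite: (29)–(30) p. 263, the shape only]; `expChart_zero`;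
  `expLine_eq_expChart` (`expLine gen (fun X _ => base₀ X) X φ ζ = expChart base₀ X (ζ • gen X φ)`, `rfl`);
  `inChart_expLine` (b13's `InChart`); `differentiableAt_expChart` (Mathlib `NormedSpace.exp_analytic`);
  `differentiableAt_comp_expChart_zero` (b13's binder (a) from b10's binders).
* §3 — THE JOIN: `derivZeroAlongV_expLine_of_linearInvariant` ((L3′) for exponential lines from (26) in the chart +
  detecting generators), `logHalfBound_secondOrder_expLine_of_linearInvariant` (rate `r − 2`),
  `bound118_secondOrder_expLine_of_linearInvariant` (rate `r − 3`), `bound118_secondOrder_expLine_of_semisimple`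
  (detecting property from the semisimple Lie model of `B13DerivZeroGauge` §3).
* §3b — RELATIVE DETECTING [cite: (26), (31)–(32) p. 264 (`𝓗(B) ∈ 𝔤`); p. 272]:
  `fderiv_apply_eq_zero_of_linearInvariant_of_mem_closure` (+ `_ball_`: `Dg(0) u = 0` for `u` in the closed span of
  the generators' ranges — b13's `fderiv_comp_eq_of_invariant` + `apply_generator_eq_zero_of_comp_eq` per image, then
  `Submodule.span_le` + `closure_minimal` on the kernel of the CLM `Dg(0)`), `derivZeroAlongV_expLine_of_mem_closure`,
  `logHalfBound_expLine_of_mem_closure` (generic letters `p + q(1 + d(X))`, constant `8((p+q)/a)²·B`, rate `r − 2`),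
  `bound118_secondOrder_expLine_of_mem_closure` (R21 letters, rate `r − 3`).
* §4 — JOINT NON-VACUITY over `M₂(ℂ)` [folklore facts about 2×2 matrices + Mathlib]: `norm_le_exp_of_mem_tube`
  (`‖V‖ ≤ e^{a}` on the tube of a C⋆-algebra); the data `mA = E₁₂`, `mC = iπE₂₁`,
  `mK = [mA, mC] = diag(iπ, −iπ)` (`mK_eq`, `mK_mem_skewAdjoint`, `mK_ne_zero`, `trace_exp_mK = −2`), `trCLM`,
  `conjCLM`, the symmetry `exT` (conjugation by `exp(t·mA)`), its velocity `exL = ad_{mA}` (`hasDerivAt_exT`), the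
  (26)-invariance in the chart `m2E_expChart_exT` (via `trace_exp_conj_exU`: Mathlib `exp_units_conj`,
  `Matrix.trace_mul_cycle`), `m2Gen`,
  `m2Base`, `m2E`, `example_logHalfBound_m2E` (`B = 3‖tr‖`, `r = 0` on the tube of half-width `1`),
  `m2Gen_mem_closure_span`, **`example_logHalfBound_expLine_m2`** (= `logHalfBound_expLine_of_mem_closure` with
  every binder discharged), `example_diffAlongV_m2` (`= −4`), `example_fderiv_apply_center` (`= 2`: the ABSOLUTE
  detecting hypothesis of §3 fails for these data).  The C⋆-structure on `M₂(ℂ)` is `B10Eq29TubeLine`'s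
  `cstarAlgebraMatrix 2`, threaded explicitly through the statements by `letI` (nothing registered as a type-class
  instance); `‖exp B‖ ≤ e^{‖B‖}` is the tree's `Literature.MathematicalPhysics.QuantumLattice.norm_exp_le`
  (imported by name, [folklore] there).

HONEST SCOPE.  Everything in the HONEST SCOPE of the two imported modules applies verbatim, in particular: MODEL not
the papers' objects (`B10Eq29TubeLine` (i)); REAL generator / real `U_{k+1}` only ((ii) there); WHICH analyticity
space carries both `TubeCfg ⊆ sp` and the undifferenced bound is undecided (GAPS C-adv2-65; (iii) there); the
(26)-invariance IN THE CHART on a ball and the detecting property are HYPOTHESES about the localized pieces (printed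
for `𝒫′₁`, `𝒫′_{k+1}` pp. 264/271, for the (61)/(63)-pieces «analyzed in the same way», GAPS C-adv2-63 R1 /
C-B13-32); the base configuration is φ-independent by construction (the fixed-point reading, C-adv2-66 R1); torus
windings / large `d(X)` (γ) untouched (the two-regime theorems of the imported modules are not re-joined here).
NON-VACUITY: joint and non-degenerate ONLY for the generic-letters relative theorem over `M₂(ℂ)` (§4); the R21-letters
corollaries (`…_of_linearInvariant`, `…_of_semisimple`, `…_of_mem_closure` with `Consts`) are that theorem followed by
the arithmetic of `B10Eq61PerSite` §5 and are not separately instantiated; over a COMMUTATIVE `𝔸` the joint binder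
list degenerates (an `E X` invariant in the sense (b) with detecting (c) is locally constant), and in the `𝔸`-valued
chart the ABSOLUTE hypothesis (c) of §3 is unsatisfiable by conjugation symmetries (§4 `example_fderiv_apply_center`)
— §3 is kept because it is b13's interface verbatim and is the right statement for charts valued in `𝔤` itself; the
cell's paper-faithful reading of *"𝔤 semi-simple"* for the model is §3b.  Whether the printed localized pieces of
(61)/(63) have generators `𝓗(B)` inside the span detected by the symmetries actually available to them (all of `G`
by (26), p. 263) is the located hypothesis `hmem`, not decided here (GAPS C-B13-32 / C-adv2-63 R1).  The module is
NOT a proof of (61)–(63), (I.1.18) or Theorem 2 and NOT summit progress: it is the kernel statement of which inputs the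
absolute second-order constant of the (61)-subtraction consumes, with one joint witness that the list is consistent
and non-trivial.
-/

noncomputable section

open Metric Set Filter NormedSpace
open scoped Topology

namespace Literature.MathematicalPhysics.QuantumFieldTheory.Balaban1983to89.B10Eq61Leaves

open B10Eq61PerSite (DerivZeroAlongV LineInStrip AnalyticOnStrip diffAlongV unitSys)
open B10Eq29TubeLine (Tube TubeCfg expLine mem_tube mem_tubeCfg bound118_secondOrder_expLine_of_R21
  logHalfBound_secondOrder_expLine_of_R21 logHalfBound_expLine_of_derivZero exp_mul_mem_tube)
open B13DerivZeroGauge (InChart inChart_of_smul derivZeroAlongV_of_linearInvariant derivZeroAlongV_of_semisimple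
  fderiv_comp_eq_of_invariant apply_generator_eq_zero_of_comp_eq eventually_invariant_of_ball)
open B12Ward414 (adConst)

/-! ## §1. [folklore] The tube is a neighbourhood of every unitary -/

section nhds

variable {𝔸 : Type*} [CStarAlgebra 𝔸]

/-- `exp` maps the neighbourhoods of `0` onto the neighbourhoods of `1` (it is a local homeomorphism at `0`: strict
derivative the identity, Mathlib `hasStrictFDerivAt_exp_zero`, `HasStrictFDerivAt.map_nhds_eq_of_equiv`). [folklore] -/
theorem map_exp_nhds_zero : map (exp : 𝔸 → 𝔸) (𝓝 0) = 𝓝 1 := by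
  have h : HasStrictFDerivAt (exp : 𝔸 → 𝔸) ((ContinuousLinearEquiv.refl ℂ 𝔸 : 𝔸 ≃L[ℂ] 𝔸) : 𝔸 →L[ℂ] 𝔸) 0 :=
    hasStrictFDerivAt_exp_zero (𝕂 := ℂ)
  simpa using h.map_nhds_eq_of_equiv

/-- **The tube of positive half-width is a neighbourhood of every unitary**: `Tube 𝔸 a ∋ V` for all `V` with
`V·U₀* ∈ exp(ball 0 a)`, a neighbourhood of `U₀` by §1's first lemma and continuity of `V ↦ V·U₀*`. [folklore] -/
theorem tube_mem_nhds_of_mem_unitary {a : ℝ} (ha : 0 < a) {U₀ : 𝔸} (hU₀ : U₀ ∈ unitary 𝔸) :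
    Tube 𝔸 a ∈ 𝓝 U₀ := by
  have hN : (exp : 𝔸 → 𝔸) '' ball (0 : 𝔸) a ∈ 𝓝 (1 : 𝔸) := by
    rw [← map_exp_nhds_zero]
    exact image_mem_map (ball_mem_nhds 0 ha)
  have hf : ContinuousAt (fun V : 𝔸 => V * star U₀) U₀ := (continuous_id.mul continuous_const).continuousAt
  have hpre : (fun V : 𝔸 => V * star U₀) ⁻¹' ((exp : 𝔸 → 𝔸) '' ball (0 : 𝔸) a) ∈ 𝓝 U₀ :=
    hf.preimage_mem_nhds (by simpa only [Unitary.mul_star_self_of_mem hU₀] using hN)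
  refine mem_of_superset hpre ?_
  rintro V ⟨B, hB, hBV⟩
  refine ⟨B, U₀, by simpa using hB, hU₀, ?_⟩
  have hBV' : exp B = V * star U₀ := hBV
  rw [hBV', mul_assoc, Unitary.star_mul_self_of_mem hU₀, mul_one]

variable {ι : Type*}

/-- The bondwise tube is the product of the one-bond tubes. [folklore] -/
theorem tubeCfg_eq_pi (a : ℝ) : TubeCfg ι 𝔸 a = Set.pi univ fun _ : ι => Tube 𝔸 a := by
  ext W
  simp [mem_tubeCfg]

variable [Finite ι]

/-- **The bondwise tube of positive half-width is a neighbourhood of every bondwise-unitary configuration** (finitely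
many bonds). [folklore] -/
theorem tubeCfg_mem_nhds {a : ℝ} (ha : 0 < a) {V : ι → 𝔸} (hV : ∀ b, V b ∈ unitary 𝔸) :
    TubeCfg ι 𝔸 a ∈ 𝓝 V := by
  rw [tubeCfg_eq_pi]
  exact set_pi_mem_nhds finite_univ fun b _ => tube_mem_nhds_of_mem_unitary ha (hV b)

end nhds

/-! ## §2. The exponential chart at a base configuration; b13's `InChart` and binder (a) for exponential lines -/

section chart

variable {D : LocDomainSys} {ι : Type*} {𝔸 : Type*} [CStarAlgebra 𝔸]

/-- THE EXPONENTIAL CHART at the base configuration `base₀ X` (model of the parametrization `U₁ = exp i𝓗` of p. 263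
around the subtracted configuration; `base₀` is φ-INDEPENDENT: the fixed point of the global action — `U_{k+1} = 1`,
for [II] `(𝐔, 𝐉) = (1, 0)`, GAPS C-adv2-66 R1).  Data of the model. [cite: Balaban1985UV3, (29)–(30) p.263] -/
def expChart (base₀ : D.Dom → ι → 𝔸) : D.Dom → (ι → 𝔸) → ι → 𝔸 := fun X v b => exp (v b) * base₀ X b

/-- The chart sends `0` to the base configuration. [folklore] -/
theorem expChart_zero (base₀ : D.Dom → ι → 𝔸) (X : D.Dom) : expChart base₀ X 0 = base₀ X := by
  funext b
  simp [expChart]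

/-- The exponential line with φ-independent base point is the chart image of the straight line `ζ ↦ ζ • gen X φ`
(definitionally). [folklore] -/
theorem expLine_eq_expChart (gen : D.Dom → (ι → 𝔸) → ι → 𝔸) (base₀ : D.Dom → ι → 𝔸) (X : D.Dom) (φ : ι → 𝔸)
    (ζ : ℂ) : expLine gen (fun X _ => base₀ X) X φ ζ = expChart base₀ X (ζ • gen X φ) := rfl

variable [Fintype ι]

/-- **b13's `InChart` for exponential lines** (via `B13DerivZeroGauge.inChart_of_smul`). [cite: Balaban1985UV3, (29)–(30) p.263] -/
theorem inChart_expLine {sp' : D.Dom → Set (ι → 𝔸)} (gen : D.Dom → (ι → 𝔸) → ι → 𝔸) (base₀ : D.Dom → ι → 𝔸) :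
    InChart (expChart base₀) sp' (expLine gen (fun X _ => base₀ X)) :=
  inChart_of_smul (expChart base₀) gen fun X φ _ ζ => expLine_eq_expChart gen base₀ X φ ζ

/-- The exponential chart is (complex-)differentiable everywhere (`exp` is entire on a Banach algebra, Mathlib
`NormedSpace.exp_analytic`; finitely many bonds). [folklore] -/
theorem differentiableAt_expChart (base₀ : D.Dom → ι → 𝔸) (X : D.Dom) (v : ι → 𝔸) :
    DifferentiableAt ℂ (expChart base₀ X) v :=
  differentiableAt_pi.mpr fun b =>
    ((exp_analytic (𝕂 := ℂ) (v b)).differentiableAt.comp v (differentiableAt_apply (𝕜 := ℂ) b v)).mul_const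
      (base₀ X b)

/-- **b13's binder (a) DERIVED from b10's binders**: base configuration bondwise unitary, `TubeCfg ι 𝔸 a ⊆ sp X` with
`0 < a`, `E X` differentiable on `sp X` ⟹ `E X ∘ expChart base₀ X` is differentiable at `0` (the tube is a
neighbourhood of the base configuration, §1). [folklore] -/
theorem differentiableAt_comp_expChart_zero {base₀ : D.Dom → ι → 𝔸} {X : D.Dom} {a : ℝ} {sp : Set (ι → 𝔸)}
    {E : (ι → 𝔸) → ℂ} (ha : 0 < a) (hbase : ∀ b, base₀ X b ∈ unitary 𝔸) (hsp : TubeCfg ι 𝔸 a ⊆ sp)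
    (hE : DifferentiableOn ℂ E sp) : DifferentiableAt ℂ (fun v => E (expChart base₀ X v)) 0 := by
  have hn : sp ∈ 𝓝 (expChart base₀ X 0) := by
    rw [expChart_zero]
    exact mem_of_superset (tubeCfg_mem_nhds ha hbase) hsp
  exact (hE.differentiableAt hn).comp 0 (differentiableAt_expChart base₀ X 0)

end chart

/-! ## §3. The join: the second-order theorems of `B10Eq61PerSite` with (L1′), (L2′), (L3′) all supplied -/

section join

variable {D : LocDomainSys} {ι : Type*} [Fintype ι] {𝔸 : Type*} [CStarAlgebra 𝔸] {Λ : Type*}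
  {sp' sp : D.Dom → Set (ι → 𝔸)} {E : D.Dom → (ι → 𝔸) → ℂ} {gen : D.Dom → (ι → 𝔸) → ι → 𝔸}
  {base₀ : D.Dom → ι → 𝔸} {nX : D.Dom → ℕ}

/-- **(L3′) for exponential lines from (26) in the chart + detecting generators**: base configuration unitary, tube
inside the analyticity space, `E X` holomorphic there (⇒ binder (a) by §2), a group acting linearly in the chart with
velocities `L l` leaving each `E X ∘ expChart base₀ X` invariant on a ball (b), generators detecting (c) ⟹
`DerivZeroAlongV sp' E (expLine gen (fun X _ => base₀ X))`. [cite: Balaban1985UV3, (26), (31)–(32) pp.263–264; p.272 (after (63))] -/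
theorem derivZeroAlongV_expLine_of_linearInvariant {a : ℝ} (ha : 0 < a) (hbase : ∀ X b, base₀ X b ∈ unitary 𝔸)
    (hsp : ∀ X, TubeCfg ι 𝔸 a ⊆ sp X) (hE : ∀ X, DifferentiableOn ℂ (E X) (sp X))
    (T : Λ → ℝ → (ι → 𝔸) →L[ℂ] (ι → 𝔸)) (L : Λ → (ι → 𝔸) →L[ℂ] (ι → 𝔸)) (α : D.Dom → ℝ) (hα : ∀ X, 0 < α X)
    (hTd : ∀ l w, HasDerivAt (fun t => T l t w) (L l w) 0)
    (hinv : ∀ X l t, ∀ v ∈ ball (0 : ι → 𝔸) (α X), T l t v ∈ ball (0 : ι → 𝔸) (α X) →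
      E X (expChart base₀ X (T l t v)) = E X (expChart base₀ X v))
    (hspan : Dense (Submodule.span ℂ (⋃ l, Set.range (L l)) : Set (ι → 𝔸))) :
    DerivZeroAlongV sp' E (expLine gen (fun X _ => base₀ X)) :=
  derivZeroAlongV_of_linearInvariant (expChart base₀) (inChart_expLine gen base₀) T L α hα
    (fun X => differentiableAt_comp_expChart_zero ha (hbase X) (hsp X) (hE X)) hTd hinv hspan

/-- **THE SUBTRACTION (61) AT SECOND ORDER, ALL THREE LEAVES SUPPLIED — per-cube form, rate `r − 2`.**
`B10Eq29TubeLine.logHalfBound_secondOrder_expLine_of_R21` ((L1′)+(L2′) discharged) with (L3′) from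
`derivZeroAlongV_expLine_of_linearInvariant`.  Binders: generator bondwise skew-adjoint with
`‖gen X φ b‖ ≤ α₁ + c₀·LM·α₀·(1 + d(X))` on `sp' X`; base configuration unitary (φ-independent); `TubeCfg ι 𝔸 a ⊆ sp X`;
`E X` holomorphic on `sp X`; (26)-invariance in the chart on a ball + detecting generators; undifferenced per-LM-cube
bound `A(LM)⁴` at rate `r`; printed R21.  Constant `16A(1 + c₀²)/a²`, independent of L, M.
[cite: Balaban1988RG2Cluster, pp.15, 20–21; Balaban1985UV3, (26), (29), (31)–(32) pp.263–264, (61) p.271, p.272] -/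
theorem logHalfBound_secondOrder_expLine_of_linearInvariant (c : B13.Consts) (h21 : c.R21)
    (hLM : 1 ≤ (c.L : ℝ) * c.M) (hα₀ : 0 ≤ c.α₀) (hα₁ : 0 < c.α₁) {A a c₀ r : ℝ} (hA : 0 ≤ A) (ha : 0 < a)
    (hc₀ : 0 ≤ c₀) (hgen : ∀ X φ, φ ∈ sp' X → ∀ b, gen X φ b ∈ skewAdjoint 𝔸)
    (hbase : ∀ X b, base₀ X b ∈ unitary 𝔸)
    (hbound : ∀ X φ, φ ∈ sp' X → ∀ b, ‖gen X φ b‖ ≤ c.α₁ + c₀ * ((c.L : ℝ) * c.M) * c.α₀ * (1 + D.dj X))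
    (hsp : ∀ X, TubeCfg ι 𝔸 a ⊆ sp X) (hE : ∀ X, DifferentiableOn ℂ (E X) (sp X))
    (T : Λ → ℝ → (ι → 𝔸) →L[ℂ] (ι → 𝔸)) (L : Λ → (ι → 𝔸) →L[ℂ] (ι → 𝔸)) (α : D.Dom → ℝ) (hα : ∀ X, 0 < α X)
    (hTd : ∀ l w, HasDerivAt (fun t => T l t w) (L l w) 0)
    (hinv : ∀ X l t, ∀ v ∈ ball (0 : ι → 𝔸) (α X), T l t v ∈ ball (0 : ι → 𝔸) (α X) →
      E X (expChart base₀ X (T l t v)) = E X (expChart base₀ X v))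
    (hspan : Dense (Submodule.span ℂ (⋃ l, Set.range (L l)) : Set (ι → 𝔸)))
    (hEb : B13.LogHalfBound D sp E nX (A * ((c.L : ℝ) * c.M) ^ 4) r) :
    B13.LogHalfBound D sp' (diffAlongV E (expLine gen (fun X _ => base₀ X))) nX
      (16 * A * (1 + c₀ ^ 2) / a ^ 2) (r - 2) :=
  logHalfBound_secondOrder_expLine_of_R21 c h21 hLM hα₀ hα₁ hA ha hc₀ hgen (fun X _ _ b => hbase X b) hbound hsp
    hE (derivZeroAlongV_expLine_of_linearInvariant ha hbase hsp hE T L α hα hTd hinv hspan) hEb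

/-- **(I.1.18) FOR THE DIFFERENCED (61)-PIECES WITH AN L, M-INDEPENDENT CONSTANT, ALL THREE LEAVES SUPPLIED — rate
`r − 3`.**  `B10Eq29TubeLine.bound118_secondOrder_expLine_of_R21` with (L3′) from
`derivZeroAlongV_expLine_of_linearInvariant`; same binders plus the volume bound.  Constant `(16A(1 + c₀²)/a²)·c₁`.
[cite: Balaban1988RG2Cluster, p.21 (closing paragraph); Balaban1985UV3, (26), (29), (31)–(32) pp.263–264, p.272] -/
theorem bound118_secondOrder_expLine_of_linearInvariant (c : B13.Consts) (h21 : c.R21)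
    (hLM : 1 ≤ (c.L : ℝ) * c.M) (hα₀ : 0 ≤ c.α₀) (hα₁ : 0 < c.α₁) {A a c₀ r c₁ : ℝ} (hA : 0 ≤ A) (ha : 0 < a)
    (hc₀ : 0 ≤ c₀) (hgen : ∀ X φ, φ ∈ sp' X → ∀ b, gen X φ b ∈ skewAdjoint 𝔸)
    (hbase : ∀ X b, base₀ X b ∈ unitary 𝔸)
    (hbound : ∀ X φ, φ ∈ sp' X → ∀ b, ‖gen X φ b‖ ≤ c.α₁ + c₀ * ((c.L : ℝ) * c.M) * c.α₀ * (1 + D.dj X))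
    (hsp : ∀ X, TubeCfg ι 𝔸 a ⊆ sp X) (hE : ∀ X, DifferentiableOn ℂ (E X) (sp X))
    (T : Λ → ℝ → (ι → 𝔸) →L[ℂ] (ι → 𝔸)) (L : Λ → (ι → 𝔸) →L[ℂ] (ι → 𝔸)) (α : D.Dom → ℝ) (hα : ∀ X, 0 < α X)
    (hTd : ∀ l w, HasDerivAt (fun t => T l t w) (L l w) 0)
    (hinv : ∀ X l t, ∀ v ∈ ball (0 : ι → 𝔸) (α X), T l t v ∈ ball (0 : ι → 𝔸) (α X) →
      E X (expChart base₀ X (T l t v)) = E X (expChart base₀ X v))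
    (hspan : Dense (Submodule.span ℂ (⋃ l, Set.range (L l)) : Set (ι → 𝔸)))
    (hEb : B13.LogHalfBound D sp E nX (A * ((c.L : ℝ) * c.M) ^ 4) r) (hvol : B13.VolBoundK1 D nX c₁)
    (hc₁ : 0 ≤ c₁) :
    B13.Bound118 D sp' (diffAlongV E (expLine gen (fun X _ => base₀ X))) (16 * A * (1 + c₀ ^ 2) / a ^ 2 * c₁)
      (r - 3) :=
  bound118_secondOrder_expLine_of_R21 c h21 hLM hα₀ hα₁ hA ha hc₀ hgen (fun X _ _ b => hbase X b) hbound hsp hE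
    (derivZeroAlongV_expLine_of_linearInvariant ha hbase hsp hE T L α hα hTd hinv hspan) hEb hvol hc₁

/-- **The same with the detecting property supplied by the semisimple Lie model of `B13DerivZeroGauge` §3**: the
chart space `ι → 𝔸` identified ℂ-linearly (`e`) with `κ → 𝔤`, `𝔤` finite-dimensional semisimple over ℂ, the
generators acting as `ad_{lam l}` variable-wise, the `lam l` spanning `𝔤` (*"R(U), U ∈ G"*, G semi-simple, p. 264).
[cite: Balaban1985UV3, (31)–(32) p.264; Balaban1987RG1, (1.19) p.263, (4.14) p.284; Balaban1988RG2Cluster, p.21] -/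
theorem bound118_secondOrder_expLine_of_semisimple {𝔤 : Type*} [LieRing 𝔤] [LieAlgebra ℂ 𝔤]
    [FiniteDimensional ℂ 𝔤] [LieAlgebra.IsSemisimple ℂ 𝔤] {κ : Type*} [Fintype κ] [DecidableEq κ]
    (c : B13.Consts) (h21 : c.R21) (hLM : 1 ≤ (c.L : ℝ) * c.M) (hα₀ : 0 ≤ c.α₀) (hα₁ : 0 < c.α₁)
    {A a c₀ r c₁ : ℝ} (hA : 0 ≤ A) (ha : 0 < a) (hc₀ : 0 ≤ c₀)
    (hgen : ∀ X φ, φ ∈ sp' X → ∀ b, gen X φ b ∈ skewAdjoint 𝔸) (hbase : ∀ X b, base₀ X b ∈ unitary 𝔸)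
    (hbound : ∀ X φ, φ ∈ sp' X → ∀ b, ‖gen X φ b‖ ≤ c.α₁ + c₀ * ((c.L : ℝ) * c.M) * c.α₀ * (1 + D.dj X))
    (hsp : ∀ X, TubeCfg ι 𝔸 a ⊆ sp X) (hE : ∀ X, DifferentiableOn ℂ (E X) (sp X))
    (T : Λ → ℝ → (ι → 𝔸) →L[ℂ] (ι → 𝔸)) (L : Λ → (ι → 𝔸) →L[ℂ] (ι → 𝔸)) (α : D.Dom → ℝ) (hα : ∀ X, 0 < α X)
    (hTd : ∀ l w, HasDerivAt (fun t => T l t w) (L l w) 0)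
    (hinv : ∀ X l t, ∀ v ∈ ball (0 : ι → 𝔸) (α X), T l t v ∈ ball (0 : ι → 𝔸) (α X) →
      E X (expChart base₀ X (T l t v)) = E X (expChart base₀ X v))
    (e : (ι → 𝔸) ≃ₗ[ℂ] (κ → 𝔤)) (lam : Λ → 𝔤) (hlam : Submodule.span ℂ (Set.range lam) = ⊤)
    (hconj : ∀ l v, e (L l v) = adConst (K := ℂ) (lam l) (e v))
    (hEb : B13.LogHalfBound D sp E nX (A * ((c.L : ℝ) * c.M) ^ 4) r) (hvol : B13.VolBoundK1 D nX c₁)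
    (hc₁ : 0 ≤ c₁) :
    B13.Bound118 D sp' (diffAlongV E (expLine gen (fun X _ => base₀ X))) (16 * A * (1 + c₀ ^ 2) / a ^ 2 * c₁)
      (r - 3) :=
  bound118_secondOrder_expLine_of_R21 c h21 hLM hα₀ hα₁ hA ha hc₀ hgen (fun X _ _ b => hbase X b) hbound hsp hE
    (derivZeroAlongV_of_semisimple (expChart base₀) (inChart_expLine gen base₀) T L α hα
      (fun X => differentiableAt_comp_expChart_zero ha (hbase X) (hsp X) (hE X)) hTd hinv e lam hlam hconj)
    hEb hvol hc₁

end join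

/-! ## §3b. Detecting generators RELATIVE to the generator subspace (the printed `𝓗(B) ∈ 𝔤`, `𝔤` semi-simple,
while the chart of the model lives in `𝔸 ⊋ 𝔤`): it suffices that the line's generator lies in the CLOSED SPAN of the
symmetry generators' ranges — no density in the whole chart space -/

section relative

variable {V : Type*} [NormedAddCommGroup V] [NormedSpace ℂ V] {F : Type*} [NormedAddCommGroup F]
  [NormedSpace ℂ F]

/-- **(26) ⇒ (32) relative to the generator subspace**: `g` differentiable at `0` and invariant near `0` under the
linear maps `T l t` (velocities `L l`); then `Dg(0)` vanishes on the CLOSURE OF THE SPAN of the ranges of the `L l` —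
the printed *"The derivative in the above formula is an element of the Lie algebra 𝔤, and by the assumption that 𝔤
is semi-simple, the only element invariant is 0"* read as a statement about the directions `𝓗(B) ∈ 𝔤` only (in the
model the chart space `ι → 𝔸` is bigger than `𝔤`: e.g. the centre of `𝔲(N)` is never detected by conjugations, §4).
Proof: b13's `fderiv_comp_eq_of_invariant` + `apply_generator_eq_zero_of_comp_eq` on each generator image, then the
kernel of the continuous linear `Dg(0)` is a closed subspace. [cite: Balaban1985UV3, (26), (31)–(32) pp.263–264] -/
theorem fderiv_apply_eq_zero_of_linearInvariant_of_mem_closure {Λ : Type*} {g : V → F}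
    (T : Λ → ℝ → V →L[ℂ] V) (L : Λ → V →L[ℂ] V) (hg : DifferentiableAt ℂ g 0)
    (hTd : ∀ l w, HasDerivAt (fun t => T l t w) (L l w) 0)
    (hinv : ∀ l t, ∀ᶠ v in 𝓝 (0 : V), g (T l t v) = g v) {u : V}
    (hu : u ∈ closure (Submodule.span ℂ (⋃ l, Set.range (L l)) : Set V)) : fderiv ℂ g 0 u = 0 := by
  have hle : Submodule.span ℂ (⋃ l, Set.range (L l)) ≤ LinearMap.ker (fderiv ℂ g 0).toLinearMap := by
    refine Submodule.span_le.2 ?_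
    rintro v hv
    obtain ⟨l, w, rfl⟩ : ∃ l w, L l w = v := by
      rcases Set.mem_iUnion.1 hv with ⟨l, w, hw⟩
      exact ⟨l, w, hw⟩
    rw [SetLike.mem_coe, LinearMap.mem_ker, ContinuousLinearMap.coe_coe]
    have h31 : ∀ᶠ t in 𝓝 (0 : ℝ), fderiv ℂ g 0 (T l t w) = fderiv ℂ g 0 w :=
      Filter.Eventually.of_forall fun t => by
        have h := congrArg (fun S : V →L[ℂ] F => S w) (fderiv_comp_eq_of_invariant (T l t) hg (hinv l t))
        simpa using h
    have h := apply_generator_eq_zero_of_comp_eq (fderiv ℂ g 0) (T := fun t => (T l t : V → V))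
      (L := fun w => L l w) (hTd l w) h31
    simpa using h
  have hcl : IsClosed {v : V | fderiv ℂ g 0 v = 0} := isClosed_eq (fderiv ℂ g 0).continuous continuous_const
  have hsub : (Submodule.span ℂ (⋃ l, Set.range (L l)) : Set V) ⊆ {v : V | fderiv ℂ g 0 v = 0} :=
    fun v hv => by
      have h := LinearMap.mem_ker.1 (hle hv)
      rw [ContinuousLinearMap.coe_coe] at h
      exact h
  exact closure_minimal hsub hcl hu

/-- The same with the invariance stated on a ball (b13's `eventually_invariant_of_ball`).
[cite: Balaban1985UV3, (26), (31)–(32) pp.263–264] -/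
theorem fderiv_apply_eq_zero_of_linearInvariant_ball_of_mem_closure {Λ : Type*} {g : V → F} {α : ℝ}
    (hα : 0 < α) (T : Λ → ℝ → V →L[ℂ] V) (L : Λ → V →L[ℂ] V) (hg : DifferentiableAt ℂ g 0)
    (hTd : ∀ l w, HasDerivAt (fun t => T l t w) (L l w) 0)
    (hinv : ∀ l t, ∀ v ∈ ball (0 : V) α, T l t v ∈ ball (0 : V) α → g (T l t v) = g v) {u : V}
    (hu : u ∈ closure (Submodule.span ℂ (⋃ l, Set.range (L l)) : Set V)) : fderiv ℂ g 0 u = 0 :=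
  fderiv_apply_eq_zero_of_linearInvariant_of_mem_closure T L hg hTd
    (fun l t => eventually_invariant_of_ball hα (T l t) (hinv l t)) hu

end relative

section joinRelative

variable {D : LocDomainSys} {ι : Type*} [Fintype ι] {𝔸 : Type*} [CStarAlgebra 𝔸] {Λ : Type*}
  {sp' sp : D.Dom → Set (ι → 𝔸)} {E : D.Dom → (ι → 𝔸) → ℂ} {gen : D.Dom → (ι → 𝔸) → ι → 𝔸}
  {base₀ : D.Dom → ι → 𝔸} {nX : D.Dom → ℕ}

/-- **(L3′) for exponential lines, relative form**: as `derivZeroAlongV_expLine_of_linearInvariant` but with the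
detecting hypothesis replaced by: the generator configuration `gen X φ` lies in the closed span of the ranges of the
symmetry generators `L l` (the printed `𝓗(B) ∈ 𝔤`).  Chain rule along `ζ ↦ ζ • gen X φ` + §3b.
[cite: Balaban1985UV3, (26), (29), (31)–(32) pp.263–264; p.272 (after (63))] -/
theorem derivZeroAlongV_expLine_of_mem_closure {a : ℝ} (ha : 0 < a) (hbase : ∀ X b, base₀ X b ∈ unitary 𝔸)
    (hsp : ∀ X, TubeCfg ι 𝔸 a ⊆ sp X) (hE : ∀ X, DifferentiableOn ℂ (E X) (sp X))
    (T : Λ → ℝ → (ι → 𝔸) →L[ℂ] (ι → 𝔸)) (L : Λ → (ι → 𝔸) →L[ℂ] (ι → 𝔸)) (α : D.Dom → ℝ) (hα : ∀ X, 0 < α X)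
    (hTd : ∀ l w, HasDerivAt (fun t => T l t w) (L l w) 0)
    (hinv : ∀ X l t, ∀ v ∈ ball (0 : ι → 𝔸) (α X), T l t v ∈ ball (0 : ι → 𝔸) (α X) →
      E X (expChart base₀ X (T l t v)) = E X (expChart base₀ X v))
    (hmem : ∀ X φ, φ ∈ sp' X → gen X φ ∈ closure (Submodule.span ℂ (⋃ l, Set.range (L l)) : Set (ι → 𝔸))) :
    DerivZeroAlongV sp' E (expLine gen (fun X _ => base₀ X)) := by
  intro X φ hφ
  have hdiff : DifferentiableAt ℂ (fun v => E X (expChart base₀ X v)) 0 :=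
    differentiableAt_comp_expChart_zero ha (hbase X) (hsp X) (hE X)
  have hγ : HasDerivAt (fun ζ : ℂ => ζ • gen X φ) (gen X φ) 0 := by
    simpa using (hasDerivAt_id (0 : ℂ)).smul_const (gen X φ)
  have hf : HasFDerivAt (fun v => E X (expChart base₀ X v)) (fderiv ℂ (fun v => E X (expChart base₀ X v)) 0)
      ((fun ζ : ℂ => ζ • gen X φ) 0) := by
    simpa only [zero_smul] using hdiff.hasFDerivAt
  have hc : HasDerivAt ((fun v => E X (expChart base₀ X v)) ∘ fun ζ : ℂ => ζ • gen X φ)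
      (fderiv ℂ (fun v => E X (expChart base₀ X v)) 0 (gen X φ)) 0 := hf.comp_hasDerivAt (0 : ℂ) hγ
  have h0 : fderiv ℂ (fun v => E X (expChart base₀ X v)) 0 (gen X φ) = 0 :=
    fderiv_apply_eq_zero_of_linearInvariant_ball_of_mem_closure (hα X) T L hdiff hTd (hinv X) (hmem X φ hφ)
  have heq : (fun ζ => E X (expLine gen (fun X _ => base₀ X) X φ ζ)) =
      ((fun v => E X (expChart base₀ X v)) ∘ fun ζ : ℂ => ζ • gen X φ) := rfl
  rw [heq, hc.deriv, h0]

/-- **THE SUBTRACTION (61) AT SECOND ORDER ALONG EXPONENTIAL LINES, generic letters, ALL THREE LEAVES SUPPLIED,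
relative detecting hypothesis** — `B10Eq29TubeLine.logHalfBound_expLine_of_derivZero` with (L3′) from
`derivZeroAlongV_expLine_of_mem_closure`: generator skew-adjoint with `‖gen X φ b‖ ≤ p + q(1 + d(X))`, lying in the
closed span of the symmetry generators' ranges; base unitary; `TubeCfg ι 𝔸 a ⊆ sp X`; `E X` holomorphic on `sp X`
and invariant in the chart; undifferenced bound `B` at rate `r` ⟹ constant `8((p + q)/a)²·B`, rate `r − 2`.
[cite: Balaban1985UV3, (26), (28)–(29) p.263, (31)–(32) p.264, (61) p.271, p.272] -/
theorem logHalfBound_expLine_of_mem_closure {B r a p q : ℝ} (ha : 0 < a) (hp : 0 ≤ p) (hq : 0 ≤ q)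
    (hpq : 0 < p + q) (hB : 0 ≤ B) (hgen : ∀ X φ, φ ∈ sp' X → ∀ b, gen X φ b ∈ skewAdjoint 𝔸)
    (hbase : ∀ X b, base₀ X b ∈ unitary 𝔸)
    (hbound : ∀ X φ, φ ∈ sp' X → ∀ b, ‖gen X φ b‖ ≤ p + q * (1 + D.dj X)) (hsp : ∀ X, TubeCfg ι 𝔸 a ⊆ sp X)
    (hE : ∀ X, DifferentiableOn ℂ (E X) (sp X))
    (T : Λ → ℝ → (ι → 𝔸) →L[ℂ] (ι → 𝔸)) (L : Λ → (ι → 𝔸) →L[ℂ] (ι → 𝔸)) (α : D.Dom → ℝ) (hα : ∀ X, 0 < α X)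
    (hTd : ∀ l w, HasDerivAt (fun t => T l t w) (L l w) 0)
    (hinv : ∀ X l t, ∀ v ∈ ball (0 : ι → 𝔸) (α X), T l t v ∈ ball (0 : ι → 𝔸) (α X) →
      E X (expChart base₀ X (T l t v)) = E X (expChart base₀ X v))
    (hmem : ∀ X φ, φ ∈ sp' X → gen X φ ∈ closure (Submodule.span ℂ (⋃ l, Set.range (L l)) : Set (ι → 𝔸)))
    (hEb : B13.LogHalfBound D sp E nX B r) :
    B13.LogHalfBound D sp' (diffAlongV E (expLine gen (fun X _ => base₀ X))) nX (8 * ((p + q) / a) ^ 2 * B)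
      (r - 2) :=
  logHalfBound_expLine_of_derivZero ha hp hq hpq hB hgen (fun X _ _ b => hbase X b) hbound hsp hE
    (derivZeroAlongV_expLine_of_mem_closure ha hbase hsp hE T L α hα hTd hinv hmem) hEb

/-- **(I.1.18) FOR THE DIFFERENCED (61)-PIECES, L, M-INDEPENDENT CONSTANT, ALL THREE LEAVES SUPPLIED, relative
detecting hypothesis** ([II]'s letters, printed R21): as `bound118_secondOrder_expLine_of_linearInvariant` with
`hspan` (density in the whole chart space) replaced by `hmem` (the generator configuration lies in the closed span of
the symmetry generators' ranges).  Constant `(16A(1 + c₀²)/a²)·c₁`, rate `r − 3`.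
[cite: Balaban1988RG2Cluster, pp.15, 20–21; Balaban1985UV3, (26), (29), (31)–(32) pp.263–264, (61) p.271, p.272] -/
theorem bound118_secondOrder_expLine_of_mem_closure (c : B13.Consts) (h21 : c.R21)
    (hLM : 1 ≤ (c.L : ℝ) * c.M) (hα₀ : 0 ≤ c.α₀) (hα₁ : 0 < c.α₁) {A a c₀ r c₁ : ℝ} (hA : 0 ≤ A) (ha : 0 < a)
    (hc₀ : 0 ≤ c₀) (hgen : ∀ X φ, φ ∈ sp' X → ∀ b, gen X φ b ∈ skewAdjoint 𝔸)
    (hbase : ∀ X b, base₀ X b ∈ unitary 𝔸)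
    (hbound : ∀ X φ, φ ∈ sp' X → ∀ b, ‖gen X φ b‖ ≤ c.α₁ + c₀ * ((c.L : ℝ) * c.M) * c.α₀ * (1 + D.dj X))
    (hsp : ∀ X, TubeCfg ι 𝔸 a ⊆ sp X) (hE : ∀ X, DifferentiableOn ℂ (E X) (sp X))
    (T : Λ → ℝ → (ι → 𝔸) →L[ℂ] (ι → 𝔸)) (L : Λ → (ι → 𝔸) →L[ℂ] (ι → 𝔸)) (α : D.Dom → ℝ) (hα : ∀ X, 0 < α X)
    (hTd : ∀ l w, HasDerivAt (fun t => T l t w) (L l w) 0)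
    (hinv : ∀ X l t, ∀ v ∈ ball (0 : ι → 𝔸) (α X), T l t v ∈ ball (0 : ι → 𝔸) (α X) →
      E X (expChart base₀ X (T l t v)) = E X (expChart base₀ X v))
    (hmem : ∀ X φ, φ ∈ sp' X → gen X φ ∈ closure (Submodule.span ℂ (⋃ l, Set.range (L l)) : Set (ι → 𝔸)))
    (hEb : B13.LogHalfBound D sp E nX (A * ((c.L : ℝ) * c.M) ^ 4) r) (hvol : B13.VolBoundK1 D nX c₁)
    (hc₁ : 0 ≤ c₁) :
    B13.Bound118 D sp' (diffAlongV E (expLine gen (fun X _ => base₀ X))) (16 * A * (1 + c₀ ^ 2) / a ^ 2 * c₁)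
      (r - 3) :=
  bound118_secondOrder_expLine_of_R21 c h21 hLM hα₀ hα₁ hA ha hc₀ hgen (fun X _ _ b => hbase X b) hbound hsp hE
    (derivZeroAlongV_expLine_of_mem_closure ha hbase hsp hE T L α hα hTd hinv hmem) hEb hvol hc₁

end joinRelative

/-! ## §4. JOINT NON-VACUITY over `M₂(ℂ)` with the paper's own mechanism: one bond, generator
`K = [E₁₂, iπE₂₁] = iπ(E₁₁ − E₂₂) ∈ 𝔰𝔲(2)`, base `1`, `E = trace` (conjugation-invariant, holomorphic, bounded on the
tube), symmetry = conjugation by `exp(tE₁₂)` read in the exponential chart (linear there), whose generator `ad_{E₁₂}`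
has `K` in its range — every binder of `logHalfBound_expLine_of_mem_closure` holds, the differenced family is `≠ 0`,
and the ABSOLUTE detecting hypothesis of §3 provably FAILS here (`D(tr ∘ exp)(0) = tr ≠ 0`: the centre is undetected) -/

section tubeNorm

variable {𝔸 : Type*} [CStarAlgebra 𝔸] [Nontrivial 𝔸]

/-- Points of the tube of half-width `a` have norm `≤ e^{a}` (`‖exp B‖ ≤ e^{‖B‖}` is the tree's [folklore]
`Literature.MathematicalPhysics.QuantumLattice.norm_exp_le`, imported by name; `‖U‖ = 1`). [folklore] -/
theorem norm_le_exp_of_mem_tube {a : ℝ} {V : 𝔸} (hV : V ∈ Tube 𝔸 a) : ‖V‖ ≤ Real.exp a := by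
  obtain ⟨B, U, hB, hU, rfl⟩ := hV
  have hU1 : ‖U‖ = 1 := CStarRing.norm_of_mem_unitary hU
  calc ‖exp B * U‖ ≤ ‖exp B‖ * ‖U‖ := norm_mul_le _ _
    _ ≤ Real.exp ‖B‖ := by rw [hU1, mul_one]; exact QuantumLattice.norm_exp_le ℂ B
    _ ≤ Real.exp a := Real.exp_le_exp.2 hB.le

end tubeNorm

section matrixExample

open scoped Matrix.Norms.L2Operator

open B10Eq29TubeLine (cstarAlgebraMatrix)

/-- `M₂(ℂ)`; its norm is Mathlib's SCOPED L²-operator norm (`open scoped Matrix.Norms.L2Operator`), and wherever a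
bundled `CStarAlgebra` structure is required the statements thread `B10Eq29TubeLine.cstarAlgebraMatrix 2` explicitly
(`letI`, as `B10Eq29TubeLine` §7 does) — nothing is registered as a type-class instance here, globally or
section-wide. [folklore] -/
abbrev M₂ : Type := Matrix (Fin 2) (Fin 2) ℂ

/-- The trace as a continuous linear functional on `M₂(ℂ)` (finite dimension). [folklore] -/
def trCLM : M₂ →L[ℂ] ℂ := LinearMap.toContinuousLinearMap (Matrix.traceLinearMap (Fin 2) ℂ ℂ)

/-- `trCLM` is the trace. [folklore] -/
theorem trCLM_apply (V : M₂) : trCLM V = Matrix.trace V := rfl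

/-- The nilpotent `A = E₁₂` generating the symmetry `t ↦ conjugation by exp(tA)`. [folklore] -/
def mA : M₂ := Matrix.of ![![0, 1], ![0, 0]]

/-- `C = iπ·E₂₁`, the preimage of the line's generator under `ad_A`. [folklore] -/
def mC : M₂ := Matrix.of ![![0, 0], ![Real.pi * Complex.I, 0]]

/-- THE LINE'S GENERATOR `K = [A, C] = iπ(E₁₁ − E₂₂) ∈ 𝔰𝔲(2)` — by construction in the range of `ad_A`.
[folklore] -/
def mK : M₂ := mA * mC - mC * mA

/-- `K = diag(iπ, −iπ)`. [folklore] -/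
theorem mK_eq : mK = Matrix.diagonal ![Real.pi * Complex.I, -(Real.pi * Complex.I)] := by
  ext i j
  fin_cases i <;> fin_cases j <;> simp [mK, mA, mC]

/-- `K` is skew-Hermitian. [folklore] -/
theorem mK_mem_skewAdjoint : mK ∈ skewAdjoint M₂ := by
  rw [skewAdjoint.mem_iff, mK_eq, Matrix.star_eq_conjTranspose, Matrix.diagonal_conjTranspose]
  ext i j
  fin_cases i <;> fin_cases j <;> simp [Matrix.diagonal, Complex.conj_ofReal]

/-- `K ≠ 0`. [folklore] -/
theorem mK_ne_zero : mK ≠ 0 := by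
  intro h
  have h1 := congr_fun (congr_fun h 0) 0
  rw [mK_eq] at h1
  simp [Real.pi_ne_zero, Complex.I_ne_zero] at h1

/-- `tr exp K = e^{iπ} + e^{−iπ} = −2`. [folklore] -/
theorem trace_exp_mK : Matrix.trace (exp mK) = -2 := by
  rw [mK_eq, Matrix.exp_diagonal, Matrix.trace_diagonal, Fin.sum_univ_two]
  have h1 : exp (Real.pi * Complex.I : ℂ) = -1 := by
    rw [← congr_fun Complex.exp_eq_exp_ℂ, Complex.exp_pi_mul_I]
  have h2 : exp (-(Real.pi * Complex.I) : ℂ) = -1 := by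
    rw [← congr_fun Complex.exp_eq_exp_ℂ, Complex.exp_neg, Complex.exp_pi_mul_I]; norm_num
  simp [h1, h2]; norm_num

/-- Bondwise two-sided multiplication `v ↦ (W·v_b·W′)_b` as a linear map (one bond). [folklore] -/
def conjLM (W W' : M₂) : (Unit → M₂) →ₗ[ℂ] (Unit → M₂) where
  toFun v := fun b => W * v b * W'
  map_add' v w := by
    funext b
    simp [mul_add, add_mul]
  map_smul' c v := by
    funext b
    simp

/-- `conjLM` as a CLM (finite dimension). [folklore] -/
def conjCLM (W W' : M₂) : (Unit → M₂) →L[ℂ] (Unit → M₂) := LinearMap.toContinuousLinearMap (conjLM W W')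

/-- Evaluation of `conjCLM`. [folklore] -/
theorem conjCLM_apply (W W' : M₂) (v : Unit → M₂) (b : Unit) : conjCLM W W' v b = W * v b * W' := rfl

/-- THE SYMMETRY IN THE CHART: conjugation by `exp(tA)` (with `exp(t(−A))` as its inverse), bondwise — the global
transformation `R(U)` of (31) read in the exponential chart at the base point `1`, where it is LINEAR.
[cite: Balaban1985UV3, (31) p.264] -/
def exT (_l : Unit) (t : ℝ) : (Unit → M₂) →L[ℂ] (Unit → M₂) :=
  conjCLM (exp ((t : ℂ) • mA)) (exp ((t : ℂ) • (-mA)))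

/-- Its generator `ad_A : v ↦ (A v_b − v_b A)_b`. [cite: Balaban1985UV3, (31)–(32) p.264] -/
def adLM : (Unit → M₂) →ₗ[ℂ] (Unit → M₂) where
  toFun v := fun b => mA * v b - v b * mA
  map_add' v w := by
    funext b
    simp only [Pi.add_apply, mul_add, add_mul]
    abel
  map_smul' c v := by
    funext b
    simp [smul_sub]

/-- `ad_A` as a CLM (the family index is `Unit`: one one-parameter group suffices here). [folklore] -/
def exL (_l : Unit) : (Unit → M₂) →L[ℂ] (Unit → M₂) := LinearMap.toContinuousLinearMap adLM

/-- Evaluation of `exL`. [folklore] -/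
theorem exL_apply (l : Unit) (v : Unit → M₂) (b : Unit) : exL l v b = mA * v b - v b * mA := rfl

/-- `exp(tA)·exp(t(−A)) = 1` (the ℚ-algebra structure Mathlib's `exp_add_of_commute` asks for is supplied inside the
proof by restriction of scalars, as in `B10Eq29TubeLine` §1). [folklore] -/
theorem exp_mA_mul_exp_neg (t : ℝ) : exp ((t : ℂ) • mA) * exp ((t : ℂ) • (-mA)) = 1 := by
  letI : NormedAlgebra ℚ M₂ := NormedAlgebra.restrictScalars ℚ ℂ M₂
  have hc : Commute ((t : ℂ) • mA) ((t : ℂ) • (-mA)) :=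
    ((Commute.refl mA).neg_right.smul_right _).smul_left _
  rw [← exp_add_of_commute hc, smul_neg, add_neg_cancel, exp_zero]

/-- `exp(t(−A))·exp(tA) = 1`. [folklore] -/
theorem exp_neg_mul_exp_mA (t : ℝ) : exp ((t : ℂ) • (-mA)) * exp ((t : ℂ) • mA) = 1 := by
  letI : NormedAlgebra ℚ M₂ := NormedAlgebra.restrictScalars ℚ ℂ M₂
  have hc : Commute ((t : ℂ) • (-mA)) ((t : ℂ) • mA) :=
    ((Commute.refl mA).neg_left.smul_right _).smul_left _
  rw [← exp_add_of_commute hc, smul_neg, neg_add_cancel, exp_zero]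

/-- `exp(tA)` as a unit of `M₂(ℂ)`. [folklore] -/
def exU (t : ℝ) : M₂ˣ := ⟨exp ((t : ℂ) • mA), exp ((t : ℂ) • (-mA)), exp_mA_mul_exp_neg t, exp_neg_mul_exp_mA t⟩

/-- **Velocity of the symmetry**: `d/dt|₀ exp(tA)·w_b·exp(−tA) = A w_b − w_b A`. [folklore] -/
theorem hasDerivAt_exT (l : Unit) (w : Unit → M₂) : HasDerivAt (fun t => exT l t w) (exL l w) 0 := by
  refine hasDerivAt_pi.2 fun b => ?_
  show HasDerivAt (fun t : ℝ => exp ((t : ℂ) • mA) * w b * exp ((t : ℂ) • (-mA))) (exL l w b) 0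
  have hof : HasDerivAt (fun t : ℝ => (t : ℂ)) 1 0 := by
    have h : HasDerivAt (⇑Complex.ofRealCLM) (Complex.ofRealCLM 1) (0 : ℝ) := Complex.ofRealCLM.hasDerivAt
    rw [Complex.ofRealCLM_apply, Complex.ofReal_one] at h
    exact h.congr_of_eventuallyEq (Filter.Eventually.of_forall fun t => (Complex.ofRealCLM_apply t).symm)
  have h1 : HasDerivAt ((fun u : ℂ => exp (u • mA)) ∘ fun t : ℝ => (t : ℂ))
      ((1 : ℂ) • (exp (((0 : ℝ) : ℂ) • mA) * mA)) 0 :=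
    (hasDerivAt_exp_smul_const mA ((0 : ℝ) : ℂ)).scomp (0 : ℝ) hof
  have h2 : HasDerivAt ((fun u : ℂ => exp (u • (-mA))) ∘ fun t : ℝ => (t : ℂ))
      ((1 : ℂ) • (exp (((0 : ℝ) : ℂ) • (-mA)) * (-mA))) 0 :=
    (hasDerivAt_exp_smul_const (-mA) ((0 : ℝ) : ℂ)).scomp (0 : ℝ) hof
  have h3 := (h1.mul_const (w b)).mul h2
  refine h3.congr_deriv ?_
  rw [exL_apply]
  simp [sub_eq_add_neg]

/-- `tr(W exp(v) W⁻¹) = tr(exp v)` for `W = exp(tA)`: conjugation invariance of the trace through the exponential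
(Mathlib `exp_units_conj`, `Matrix.trace_mul_cycle`; the ℚ-structure again supplied in the proof). [folklore] -/
theorem trace_exp_conj_exU (t : ℝ) (x : M₂) :
    Matrix.trace (exp ((exU t : M₂) * x * (↑(exU t)⁻¹ : M₂))) = Matrix.trace (exp x) := by
  letI : NormedAlgebra ℚ M₂ := NormedAlgebra.restrictScalars ℚ ℂ M₂
  rw [exp_units_conj, Matrix.trace_mul_cycle, Units.inv_mul, one_mul]

/-- Example data, one bond over `M₂(ℂ)`: constant generator `K`. [folklore] -/
def m2Gen (_X : unitSys.Dom) (_φ : Unit → M₂) (_b : Unit) : M₂ := mK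

/-- Example base configuration `1` (φ-independent). [folklore] -/
def m2Base (_X : unitSys.Dom) (_b : Unit) : M₂ := 1

/-- Example family `E X V = tr V` (conjugation-invariant, holomorphic; its composition with the exponential chart has
vanishing derivative at `0` ALONG 𝔰𝔩₂ but NOT along the centre). [folklore] -/
def m2E (_X : unitSys.Dom) (V : Unit → M₂) : ℂ := trCLM (V ())

/-- `E = tr` is differentiable everywhere. [folklore] -/
theorem differentiable_m2E (X : unitSys.Dom) : Differentiable ℂ (m2E X) := fun V =>
  (trCLM.differentiableAt).comp V (differentiableAt_apply (𝕜 := ℂ) () V)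

/-- **(26) in the chart for `E = trace`**: `tr(exp(W v W⁻¹)·1) = tr(W exp(v) W⁻¹) = tr(exp v·1)`, for ALL `v` (no
ball restriction needed). [cite: Balaban1985UV3, (26), (31) pp.263–264] -/
theorem m2E_expChart_exT (X : unitSys.Dom) (l : Unit) (t : ℝ) (v : Unit → M₂) :
    letI := cstarAlgebraMatrix 2
    m2E X (expChart (D := unitSys) m2Base X (exT l t v)) = m2E X (expChart (D := unitSys) m2Base X v) := by
  letI := cstarAlgebraMatrix 2
  simp only [m2E, expChart, m2Base, mul_one, trCLM_apply]
  exact trace_exp_conj_exU t (v ())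

/-- The undifferenced bound on the bondwise tube of half-width `1`: `|tr V| ≤ ‖tr‖·‖V‖ ≤ ‖tr‖·e ≤ 3‖tr‖`
(`nX ≡ 1`, rate `0`). [folklore] -/
theorem example_logHalfBound_m2E :
    letI := cstarAlgebraMatrix 2
    B13.LogHalfBound unitSys (fun _ => TubeCfg Unit M₂ 1) m2E (fun _ => 1) (3 * ‖trCLM‖) 0 := by
  letI := cstarAlgebraMatrix 2
  intro X V hV
  have h1 : ‖V ()‖ ≤ 3 := (norm_le_exp_of_mem_tube (mem_tubeCfg.1 hV ())).trans (by
    have := Real.exp_one_lt_d9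
    linarith)
  have h2 : ‖trCLM (V ())‖ ≤ ‖trCLM‖ * 3 :=
    (trCLM.le_opNorm (V ())).trans (mul_le_mul_of_nonneg_left h1 (norm_nonneg _))
  have h3 : ‖m2E X V‖ ≤ 3 * ‖trCLM‖ := by
    rw [m2E, mul_comm]
    exact h2
  simpa using h3

/-- `K ∈ range(ad_A) ⊆` the closed span of the symmetry generators' ranges (`K = ad_A(C)` by construction).
[folklore] -/
theorem m2Gen_mem_closure_span (X : unitSys.Dom) (φ : Unit → M₂) :
    m2Gen X φ ∈ closure (Submodule.span ℂ (⋃ l, Set.range (exL l)) : Set (Unit → M₂)) := by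
  refine subset_closure (Submodule.subset_span (Set.mem_iUnion.2 ⟨(), ⟨fun _ => mC, ?_⟩⟩))
  funext b
  rfl

/-- **JOINT NON-VACUITY**: every binder of `logHalfBound_expLine_of_mem_closure` holds for the `M₂(ℂ)` data
(evaluation space = everything, analyticity space = the bondwise tube of half-width `1`, `p = ‖K‖`, `q = 0`,
`B = 3‖tr‖`, `r = 0`, symmetry = conjugation by `exp(tA)`, (L3′) DERIVED from (26) in the chart). [folklore] -/
theorem example_logHalfBound_expLine_m2 :
    letI := cstarAlgebraMatrix 2
    B13.LogHalfBound unitSys (fun _ => univ) (diffAlongV m2E (expLine m2Gen (fun X _ => m2Base X))) (fun _ => 1)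
      (8 * ((‖mK‖ + 0) / 1) ^ 2 * (3 * ‖trCLM‖)) (0 - 2) := by
  letI := cstarAlgebraMatrix 2
  exact logHalfBound_expLine_of_mem_closure (sp := fun _ => TubeCfg Unit M₂ 1) one_pos (norm_nonneg mK) le_rfl
    (by simpa using norm_pos_iff.2 mK_ne_zero) (by positivity) (fun _ _ _ _ => mK_mem_skewAdjoint)
    (fun _ _ => Submonoid.one_mem _) (fun _ _ _ _ => by simp [m2Gen]) (fun _ => Subset.rfl)
    (fun X => (differentiable_m2E X).differentiableOn) exT exL (fun _ => 1) (fun _ => one_pos) hasDerivAt_exT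
    (fun X l t v _ _ => m2E_expChart_exT X l t v) (fun X φ _ => m2Gen_mem_closure_span X φ)
    example_logHalfBound_m2E

/-- **…and non-degenerately**: the differenced family at the configuration `1` is `tr exp K − tr 1 = −2 − 2 = −4 ≠ 0`.
[folklore] -/
theorem example_diffAlongV_m2 (X : unitSys.Dom) :
    letI := cstarAlgebraMatrix 2
    diffAlongV m2E (expLine m2Gen (fun X _ => m2Base X)) X (fun _ => 1) = -4 := by
  letI := cstarAlgebraMatrix 2
  simp only [diffAlongV, expLine, m2E, m2Gen, m2Base, one_smul, zero_smul, exp_zero, mul_one, trCLM_apply,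
    trace_exp_mK, Matrix.trace_one, Fintype.card_fin]
  norm_num

/-- **THE ABSOLUTE DETECTING HYPOTHESIS OF §3 FAILS HERE**: `D(E ∘ expChart)(0)` applied to the central direction
`1` is `tr 1 = 2 ≠ 0`, so `Dg(0) ≠ 0` and no family of chart-symmetries of `E = tr` can have densely spanning
generators (b13's `fderiv_eq_zero_of_linearInvariant_ball` would give `Dg(0) = 0`) — the centre of `𝔲(2)` is not
detected by conjugations; the RELATIVE theorem `logHalfBound_expLine_of_mem_closure` is what applies. [folklore] -/
theorem example_fderiv_apply_center (X : unitSys.Dom) :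
    letI := cstarAlgebraMatrix 2
    fderiv ℂ (fun v : Unit → M₂ => m2E X (expChart (D := unitSys) m2Base X v)) 0 (fun _ => 1) = 2 := by
  letI := cstarAlgebraMatrix 2
  have hfun : (fun v : Unit → M₂ => m2E X (expChart (D := unitSys) m2Base X v)) =
      fun v => trCLM (exp (v ())) := by
    funext v
    simp [m2E, expChart, m2Base]
  have h1 : HasFDerivAt (fun v : Unit → M₂ => v ()) (ContinuousLinearMap.proj (R := ℂ) ()) 0 :=
    (ContinuousLinearMap.proj (R := ℂ) (φ := fun _ : Unit => M₂) ()).hasFDerivAt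
  have h2 : HasFDerivAt (fun v : Unit → M₂ => exp (v ()))
      ((1 : M₂ →L[ℂ] M₂).comp (ContinuousLinearMap.proj (R := ℂ) ())) 0 :=
    (hasFDerivAt_exp_zero (𝕂 := ℂ)).comp (0 : Unit → M₂) h1
  have h3 : HasFDerivAt (fun v : Unit → M₂ => trCLM (exp (v ())))
      (trCLM.comp ((1 : M₂ →L[ℂ] M₂).comp (ContinuousLinearMap.proj (R := ℂ) ()))) 0 :=
    trCLM.hasFDerivAt.comp (0 : Unit → M₂) h2
  rw [hfun, h3.fderiv]
  simp [trCLM_apply, Matrix.trace_one]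

end matrixExample

end Literature.MathematicalPhysics.QuantumFieldTheory.Balaban1983to89.B10Eq61Leaves
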